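import Literature.AnabelianGeometry.AbsoluteAnabelian.NeukirchUchidaUniquenessProofs
import Literature.AnabelianGeometry.AbsoluteAnabelian.NeukirchUchidaTransportGamma
import Mathlib.FieldTheory.KrullTopology
import Mathlib.FieldTheory.Normal.Closure
import HarnessLib

/-!
# The Neukirch–Uchida deduction, row R7: reduction to a finite Galois level (slimness) and the
# existence of small finite Galois levels

J. Neukirch, A. Schmidt, K. Wingberg, *Cohomology of Number Fields* (2nd ed.), Ch. XII §2, proof of
Thm. (12.2.1) (Neukirch–Uchida), last paragraph: once a topological isomorphism `α : U₁ ⥲ U₂` between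
open subgroups of `G_F = Gal(F̄/F)` is known to be conjugation by some `τ ∈ G_F` ON A SMALLER OPEN
SUBGROUP `Gal(F̄/N) ⊆ U₁` (`N/F` finite Galois), it is conjugation by `τ` on all of `U₁` — because
`G_F` is SLIM (centralisers of open subgroups are trivial, [AbsAnab] Thm 1.1.1 (ii),
`galoisNF_slim_holds`); and such levels `N` exist below any open `U₁`, finite Galois over `F` and
containing any prescribed finite set of algebraic numbers (e.g. a primitive `ℓ`-th root of unity).

PROOF-ONLY (no `def`).  abc-iut cell, GAP-LEDGER row G-L4d2g4-1, sub-DAG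
`plan/L4/SUBDAG-NeukirchUchida.md` row R7 REDUCTION (seat abc-iut-w6-d108; holder abc-iut-L4-d2):

* `eq_conj_of_eq_conj_on_isOpen` — PURE GROUP THEORY: `Γ` a slim topological group, `U₁ ≤ Γ`,
  `φ : U₁ →* Γ` a homomorphism, `N ≤ U₁` an OPEN subgroup of `Γ` and `τ ∈ Γ` with
  `φ(n) = τ n τ⁻¹` for all `n ∈ N`; then `φ(u) = τ u τ⁻¹` for all `u ∈ U₁` (the element
  `u⁻¹ τ⁻¹ φ(u) τ` centralises the open subgroup `N ∩ u⁻¹ N u`);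
  `eq_conj_of_eq_conj_on_isOpen_mulEquiv` — the same for a partial isomorphism `α : U₁ ≃* U₂`;
* `exists_finiteDimensional_isGalois_fixingSubgroup_le` — for an open `U ≤ G_F` (`F` perfect, e.g. a
  number field) and a finite set `S ⊆ F̄`: a finite Galois `N/F` inside `F̄` with `S ⊆ N` and
  `Gal(F̄/N) ≤ U` (normal closure of `E(S)` for a Krull-basic `Gal(F̄/E) ⊆ U`);
  `exists_finiteDimensional_isGalois_primitiveRoot_fixingSubgroup_le` — the same with a primitive
  `ℓ`-th root of unity in `N` (`exists_isPrimitiveRoot_algebraicClosure`);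
* `eq_conj_of_eq_conj_on_fixingSubgroup` — R7 as consumed by the deduction: `G_F` slim (number field
  `F`), `α : U₁ ≃* U₂`, `N/F` finite with `Gal(F̄/N) ≤ U₁`, `α = conj τ` on `Gal(F̄/N)` ⇒ `α = conj τ`
  on `U₁`; and `forall_smul_eq_of_forall_eq_conj` — the END ADAPTER: `α = conj τ` on `U₁` gives the
  conclusion of `NeukirchUchida F` for `(U₁, U₂, α)` with the field automorphism underlying `τ`;
* `eq_conj_of_eq_conj_on_ΓK`, `exists_isGalois_primitiveRoot_ΓK_le`, `exists_isGalois_subset_ΓK_le`,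
  `exists_ringEquiv_of_eq_conj_on_ΓK` — the same in the sub-DAG §INTERFACES currency
  (`Γ = G_ℚ`, `Ω = ℚ̄`, `ΓK` of `NeukirchUchidaTransportGamma`, abc-iut-w6-d055).

HONEST FRAMING: classical group theory / Galois theory, outside the [IUTchIII] Cor. 3.12 cone;
nothing here takes a side; typed ≠ proved elsewhere, but everything in THIS file is proved.

## References
* [NeukirchSchmidtWingberg2008] Neukirch–Schmidt–Wingberg, *Cohomology of Number Fields*, Thm (12.2.1) and its proof.
* [MochizukiAbsAnab2004] S. Mochizuki, *The absolute anabelian geometry of hyperbolic curves*, Thm 1.1.1 (ii), Thm 1.1.3 p. 6.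
-/

noncomputable section

open scoped Pointwise Topology
open Field

namespace Literature.AnabelianGeometry.AbsoluteAnabelian

namespace NeukirchUchidaProof

open Literature.AlgebraicGeometry.Frobenioids (IsSlimGroup)
open Literature.NumberTheory.GaloisRepresentations

/-! ### Pure group theory: conjugacy on an open subgroup propagates (slimness) -/

section Slim

variable {Γ : Type*} [Group Γ] [TopologicalSpace Γ] [IsTopologicalGroup Γ]

/-- **Conjugacy on an open subgroup propagates to the whole domain, for a slim group.**  Let `Γ` be
a slim topological group (`IsSlimGroup`: centralisers of open subgroups are trivial), `U₁ ≤ Γ`,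
`φ : U₁ →* Γ` a homomorphism, `N ≤ U₁` a subgroup of `Γ` which is OPEN in `Γ`, and `τ ∈ Γ` with
`φ(n) = τ n τ⁻¹` for every `n ∈ N`.  Then `φ(u) = τ u τ⁻¹` for every `u ∈ U₁`.  Proof: for
`n ∈ N ∩ u⁻¹Nu`… precisely for `n ∈ N` with `u n u⁻¹ ∈ N`, comparing the two expressions of
`φ(u n u⁻¹)` shows that `x = u⁻¹ τ⁻¹ φ(u) τ` commutes with `n`; these `n` form an open subgroup, so
`x = 1` by slimness.  (Last step of the proof of [NSW] (12.2.1).)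
[cite: NeukirchSchmidtWingberg2008, Thm (12.2.1)] -/
theorem eq_conj_of_eq_conj_on_isOpen (hΓ : IsSlimGroup Γ) {U₁ : Subgroup Γ} (φ : U₁ →* Γ)
    {N : Subgroup Γ} (hN : IsOpen (N : Set Γ)) (hNU : N ≤ U₁) (τ : Γ)
    (hτ : ∀ (n : Γ) (hn : n ∈ N), φ ⟨n, hNU hn⟩ = τ * n * τ⁻¹) (u : U₁) :
    φ u = τ * u * τ⁻¹ := by
  -- the open subgroup `N' = {n ∈ N | u n u⁻¹ ∈ N}`
  set N' : Subgroup Γ := N ⊓ N.comap (MulAut.conj (u : Γ)).toMonoidHom with hN'def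
  have hN'open : IsOpen (N' : Set Γ) := by
    have hc : Continuous fun g : Γ => (u : Γ) * g * (u : Γ)⁻¹ :=
      (continuous_const.mul continuous_id).mul continuous_const
    rw [hN'def, Subgroup.coe_inf, Subgroup.coe_comap]
    exact hN.inter (hN.preimage hc)
  -- `x = u⁻¹ τ⁻¹ φ(u) τ` centralises `N'`
  set x : Γ := (u : Γ)⁻¹ * τ⁻¹ * φ u * τ with hxdef
  have hxc : x ∈ Subgroup.centralizer (N' : Set Γ) := by
    rw [Subgroup.mem_centralizer_iff]
    intro n hn
    have hn' : n ∈ N' := hn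
    rw [hN'def, Subgroup.mem_inf, Subgroup.mem_comap] at hn'
    obtain ⟨hnN, hnc⟩ := hn'
    have hnc' : (u : Γ) * n * (u : Γ)⁻¹ ∈ N := by
      simpa only [MulEquiv.coe_toMonoidHom, MulAut.conj_apply] using hnc
    -- the two expressions of `φ (u n u⁻¹)`
    have h1 : φ ⟨(u : Γ) * n * (u : Γ)⁻¹, hNU hnc'⟩ = τ * ((u : Γ) * n * (u : Γ)⁻¹) * τ⁻¹ :=
      hτ _ hnc'
    have h2 : φ ⟨(u : Γ) * n * (u : Γ)⁻¹, hNU hnc'⟩ = φ u * (τ * n * τ⁻¹) * (φ u)⁻¹ := by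
      have hmk : (⟨(u : Γ) * n * (u : Γ)⁻¹, hNU hnc'⟩ : U₁) = u * ⟨n, hNU hnN⟩ * u⁻¹ :=
        Subtype.ext rfl
      rw [hmk, map_mul, map_mul, map_inv, hτ n hnN]
    have key : φ u * (τ * n * τ⁻¹) * (φ u)⁻¹ = τ * ((u : Γ) * n * (u : Γ)⁻¹) * τ⁻¹ :=
      h2.symm.trans h1
    -- hence `x n x⁻¹ = n`
    have e1 : x * n * x⁻¹ = (u : Γ)⁻¹ * τ⁻¹ * (φ u * (τ * n * τ⁻¹) * (φ u)⁻¹) * τ * (u : Γ) := by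
      rw [hxdef]; group
    rw [key] at e1
    have e2 : x * n * x⁻¹ = n := by rw [e1]; group
    calc n * x = x * n * x⁻¹ * x := by rw [e2]
      _ = x * n := by group
  -- slimness: `x = 1`
  have hx1 : x = 1 := by
    have h := hΓ.centralizer_eq_bot N' hN'open
    rw [h] at hxc
    exact Subgroup.mem_bot.mp hxc
  -- unwind
  calc φ u = τ * (u : Γ) * x * τ⁻¹ := by rw [hxdef]; group
    _ = τ * u * τ⁻¹ := by rw [hx1, mul_one]

/-- The same for a partial isomorphism `α : U₁ ≃* U₂` between subgroups of a slim group `Γ`, in the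
coercion spelling of `NeukirchUchida F` (`((α u : U₂) : Γ)`): if `α(n) = τ n τ⁻¹` on an open subgroup
`N ≤ U₁` of `Γ`, then `α(u) = τ u τ⁻¹` on `U₁`. [cite: NeukirchSchmidtWingberg2008, Thm (12.2.1)] -/
theorem eq_conj_of_eq_conj_on_isOpen_mulEquiv (hΓ : IsSlimGroup Γ) {U₁ U₂ : Subgroup Γ} (α : U₁ ≃* U₂)
    {N : Subgroup Γ} (hN : IsOpen (N : Set Γ)) (hNU : N ≤ U₁) (τ : Γ)
    (hτ : ∀ (n : Γ) (hn : n ∈ N), ((α ⟨n, hNU hn⟩ : U₂) : Γ) = τ * n * τ⁻¹) (u : U₁) :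
    ((α u : U₂) : Γ) = τ * u * τ⁻¹ :=
  eq_conj_of_eq_conj_on_isOpen hΓ (U₂.subtype.comp α.toMonoidHom) hN hNU τ hτ u

end Slim

/-! ### Small finite Galois levels below an open subgroup of `G_F` -/

section Levels

variable (F : Type*) [Field F]

/-- **Finite Galois levels below an open subgroup.**  For a perfect field `F` (e.g. a number field),
an OPEN subgroup `U ≤ G_F = Gal(F̄/F)` and a finite set `S ⊆ F̄`, there is a finite Galois extension
`N/F` inside `F̄` containing `S` with `Gal(F̄/N) ≤ U`: the Krull topology gives a finite `E/F` with
`Gal(F̄/E) ⊆ U`; take `N` = the normal closure of `E(S)`.  (In the Neukirch–Uchida deduction: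
«WLOG `U₁ = U₂ = Gal(F̄/N)`, `N/ℚ` Galois, `μ_ℓ ⊆ N`».) [cite: NeukirchSchmidtWingberg2008, Thm (12.2.1)] -/
theorem exists_finiteDimensional_isGalois_fixingSubgroup_le [PerfectField F]
    (U : Subgroup (absoluteGaloisGroup F)) (hU : IsOpen (U : Set (absoluteGaloisGroup F)))
    (S : Set (AlgebraicClosure F)) (hS : S.Finite) :
    ∃ N : IntermediateField F (AlgebraicClosure F), FiniteDimensional F N ∧ IsGalois F N ∧
      S ⊆ N ∧ N.fixingSubgroup.comap (absoluteGaloisGroup.toAlgEquiv F).toMonoidHom ≤ U := by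
  classical
  -- a Krull-basic open `Gal(F̄/E) ⊆ U`, `E/F` finite (`Field.absoluteGaloisGroup F` is `F̄ ≃ₐ[F] F̄`)
  have hU1 : ((U : Set (absoluteGaloisGroup F)) :
      Set (AlgebraicClosure F ≃ₐ[F] AlgebraicClosure F)) ∈
        𝓝 (1 : AlgebraicClosure F ≃ₐ[F] AlgebraicClosure F) :=
    hU.mem_nhds U.one_mem
  obtain ⟨E, hEfd, hEU⟩ := (krullTopology_mem_nhds_one_iff F (AlgebraicClosure F) _).mp hU1
  haveI := hEfd
  -- `E(S)` is finite over `F`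
  haveI : Finite S := hS.to_subtype
  haveI : FiniteDimensional F (IntermediateField.adjoin F S) :=
    IntermediateField.finiteDimensional_adjoin fun x _ => (Algebra.IsAlgebraic.isAlgebraic x).isIntegral
  set E' : IntermediateField F (AlgebraicClosure F) := E ⊔ IntermediateField.adjoin F S with hE'def
  haveI : FiniteDimensional F E' := IntermediateField.finiteDimensional_sup E (IntermediateField.adjoin F S)
  -- its normal closure `N`
  set N : IntermediateField F (AlgebraicClosure F) :=
    IntermediateField.normalClosure F E' (AlgebraicClosure F) with hNdef
  haveI : FiniteDimensional F N := normalClosure.is_finiteDimensional F E' (AlgebraicClosure F)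
  haveI : Normal F N := normalClosure.normal F E' (AlgebraicClosure F)
  haveI : IsGalois F N := { }
  have hE'N : E' ≤ N := IntermediateField.le_normalClosure E'
  refine ⟨N, inferInstance, inferInstance, ?_, ?_⟩
  · intro x hx
    exact hE'N (le_sup_right (b := IntermediateField.adjoin F S) (IntermediateField.subset_adjoin F S hx))
  · intro σ hσ
    rw [Subgroup.mem_comap] at hσ
    have hσE : (absoluteGaloisGroup.toAlgEquiv F).toMonoidHom σ ∈ E.fixingSubgroup :=
      IntermediateField.fixingSubgroup_antitone (le_sup_left.trans hE'N) hσ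
    exact hEU hσE

/-- Variant with ONE prescribed element (e.g. `ζ_ℓ ∈ N`). [cite: NeukirchSchmidtWingberg2008, Thm (12.2.1)] -/
theorem exists_finiteDimensional_isGalois_mem_fixingSubgroup_le [PerfectField F]
    (U : Subgroup (absoluteGaloisGroup F)) (hU : IsOpen (U : Set (absoluteGaloisGroup F)))
    (ζ : AlgebraicClosure F) :
    ∃ N : IntermediateField F (AlgebraicClosure F), FiniteDimensional F N ∧ IsGalois F N ∧
      ζ ∈ N ∧ N.fixingSubgroup.comap (absoluteGaloisGroup.toAlgEquiv F).toMonoidHom ≤ U := by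
  obtain ⟨N, h1, h2, h3, h4⟩ :=
    exists_finiteDimensional_isGalois_fixingSubgroup_le F U hU {ζ} (Set.finite_singleton ζ)
  exact ⟨N, h1, h2, h3 (Set.mem_singleton ζ), h4⟩

/-- A field of characteristic zero has primitive `ℓ`-th roots of unity in its algebraic closure
(`ℓ ≥ 1`): a root of the cyclotomic polynomial `Φ_ℓ`. [folklore] -/
private theorem exists_isPrimitiveRoot_algebraicClosure [CharZero F] {ℓ : ℕ} (hℓ : 0 < ℓ) :
    ∃ ζ : AlgebraicClosure F, IsPrimitiveRoot ζ ℓ := by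
  haveI : NeZero (ℓ : AlgebraicClosure F) := ⟨Nat.cast_ne_zero.mpr hℓ.ne'⟩
  have hdeg : (Polynomial.cyclotomic ℓ (AlgebraicClosure F)).degree ≠ 0 := by
    rw [Polynomial.degree_cyclotomic]
    exact_mod_cast (Nat.totient_pos.mpr hℓ).ne'
  obtain ⟨ζ, hζ⟩ := IsAlgClosed.exists_root _ hdeg
  exact ⟨ζ, Polynomial.isRoot_cyclotomic_iff.mp hζ⟩

/-- **R7 (b) as consumed**: below an open `U ≤ G_F` (`F` of characteristic zero) there is a finite
GALOIS `N/F` inside `F̄` CONTAINING A PRIMITIVE `ℓ`-TH ROOT OF UNITY with `Gal(F̄/N) ≤ U` («WLOG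
`U₁ = U₂ = Γ_N`, `N/ℚ` Galois, `μ_ℓ ⊆ N`»). [cite: NeukirchSchmidtWingberg2008, Thm (12.2.1)] -/
theorem exists_finiteDimensional_isGalois_primitiveRoot_fixingSubgroup_le [CharZero F]
    (U : Subgroup (absoluteGaloisGroup F)) (hU : IsOpen (U : Set (absoluteGaloisGroup F)))
    {ℓ : ℕ} (hℓ : 0 < ℓ) :
    ∃ N : IntermediateField F (AlgebraicClosure F), FiniteDimensional F N ∧ IsGalois F N ∧
      N.fixingSubgroup.comap (absoluteGaloisGroup.toAlgEquiv F).toMonoidHom ≤ U ∧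
      ∃ ζ : AlgebraicClosure F, ζ ∈ N ∧ IsPrimitiveRoot ζ ℓ := by
  obtain ⟨ζ, hζ⟩ := exists_isPrimitiveRoot_algebraicClosure F hℓ
  obtain ⟨N, h1, h2, h3, h4⟩ :=
    exists_finiteDimensional_isGalois_mem_fixingSubgroup_le F U hU ζ
  exact ⟨N, h1, h2, h4, ζ, h3, hζ⟩

/-- `Gal(F̄/N)` is open in `G_F` for `N/F` finite (transport of Mathlib's
`IntermediateField.fixingSubgroup_isOpen` to `Field.absoluteGaloisGroup`). [folklore] -/
private theorem isOpen_comap_fixingSubgroup (N : IntermediateField F (AlgebraicClosure F)) [FiniteDimensional F N] :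
    IsOpen ((N.fixingSubgroup.comap (absoluteGaloisGroup.toAlgEquiv F).toMonoidHom :
      Subgroup (absoluteGaloisGroup F)) : Set (absoluteGaloisGroup F)) :=
  N.fixingSubgroup_isOpen

end Levels

/-! ### R7 for `G_F`, `F` a number field -/

section NumberField

variable {F : Type} [Field F] [NumberField F]

/-- **R7 REDUCTION.**  `F` a number field, `U₁, U₂ ≤ G_F`, `α : U₁ ≃* U₂`, `N/F` finite inside `F̄`
with `Gal(F̄/N) ≤ U₁`, and `τ ∈ G_F` such that `α(n) = τ n τ⁻¹` for all `n ∈ Gal(F̄/N)`.  Then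
`α(u) = τ u τ⁻¹` for all `u ∈ U₁` (slimness of `G_F`, [AbsAnab] Thm 1.1.1 (ii) `galoisNF_slim_holds`).
[cite: NeukirchSchmidtWingberg2008, Thm (12.2.1)] [cite: MochizukiAbsAnab2004, Thm 1.1.1 (ii) p.6] -/
theorem eq_conj_of_eq_conj_on_fixingSubgroup {U₁ U₂ : Subgroup (absoluteGaloisGroup F)} (α : U₁ ≃* U₂)
    (N : IntermediateField F (AlgebraicClosure F)) [FiniteDimensional F N]
    (hNU : N.fixingSubgroup.comap (absoluteGaloisGroup.toAlgEquiv F).toMonoidHom ≤ U₁)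
    (τ : absoluteGaloisGroup F)
    (hτ : ∀ (n : absoluteGaloisGroup F)
      (hn : n ∈ N.fixingSubgroup.comap (absoluteGaloisGroup.toAlgEquiv F).toMonoidHom),
      ((α ⟨n, hNU hn⟩ : U₂) : absoluteGaloisGroup F) = τ * n * τ⁻¹) (u : U₁) :
    ((α u : U₂) : absoluteGaloisGroup F) = τ * u * τ⁻¹ :=
  eq_conj_of_eq_conj_on_isOpen_mulEquiv (galoisNF_slim_holds F) α (isOpen_comap_fixingSubgroup F N)
    hNU τ hτ u

omit [NumberField F] in
/-- **END ADAPTER.**  If `α : U₁ ⥲ U₂` is conjugation by `τ ∈ G_F` on `U₁`, then the field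
automorphism underlying `τ` induces `α` in the sense of `NeukirchUchida F`:
`α(u)(τ x) = τ(u x)` for all `u ∈ U₁`, `x ∈ F̄`. [cite: NeukirchSchmidtWingberg2008, Thm (12.2.1)] -/
theorem forall_smul_eq_of_forall_eq_conj {U₁ U₂ : Subgroup (absoluteGaloisGroup F)} (α : U₁ ≃* U₂)
    (τ : absoluteGaloisGroup F)
    (hτ : ∀ u : U₁, ((α u : U₂) : absoluteGaloisGroup F) = τ * u * τ⁻¹) :
    ∀ (u : U₁) (x : AlgebraicClosure F),
      ((α u : U₂) : absoluteGaloisGroup F) • ((absoluteGaloisGroup.toAlgEquiv F τ).toRingEquiv x) =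
        (absoluteGaloisGroup.toAlgEquiv F τ).toRingEquiv ((u : absoluteGaloisGroup F) • x) := by
  intro u x
  rw [hτ u, mul_smul, mul_smul]
  change τ • (u : absoluteGaloisGroup F) • τ⁻¹ • τ • x = τ • (u : absoluteGaloisGroup F) • x
  rw [inv_smul_smul]

omit [NumberField F] in
/-- The `NeukirchUchida F` conclusion for `(U₁, U₂, α)` from «`α = conj τ` on `U₁`», packaged as the
existential the named fact asks for. [cite: NeukirchSchmidtWingberg2008, Thm (12.2.1)] -/
theorem exists_ringEquiv_of_forall_eq_conj {U₁ U₂ : Subgroup (absoluteGaloisGroup F)} (α : U₁ ≃* U₂)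
    (τ : absoluteGaloisGroup F)
    (hτ : ∀ u : U₁, ((α u : U₂) : absoluteGaloisGroup F) = τ * u * τ⁻¹) :
    ∃ ρ : AlgebraicClosure F ≃+* AlgebraicClosure F, ∀ (u : U₁) (x : AlgebraicClosure F),
      ((α u : U₂) : absoluteGaloisGroup F) • ρ x = ρ ((u : absoluteGaloisGroup F) • x) :=
  ⟨(absoluteGaloisGroup.toAlgEquiv F τ).toRingEquiv, forall_smul_eq_of_forall_eq_conj α τ hτ⟩

end NumberField

/-! ### R7 in the §INTERFACES currency of the sub-DAG (`Γ = G_ℚ`, `Ω = ℚ̄`, `ΓK`) -/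

section Rat

/-- **R7 (a) REDUCTION, sub-DAG currency** (`Γ = absoluteGaloisGroup ℚ`, `ΓK N` of
`NeukirchUchidaTransportGamma`): for `U₁ U₂ ≤ Γ`, `α : U₁ ≃* U₂`, `N/ℚ` finite inside `ℚ̄` with
`Γ_N ≤ U₁`, and `τ ∈ Γ` with `α(n) = τ n τ⁻¹` on `Γ_N`: `α(u) = τ u τ⁻¹` on `U₁` (slimness of `G_ℚ`).
[cite: NeukirchSchmidtWingberg2008, Thm (12.2.1)] [cite: MochizukiAbsAnab2004, Thm 1.1.1 (ii) p.6] -/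
theorem eq_conj_of_eq_conj_on_ΓK {U₁ U₂ : Subgroup (absoluteGaloisGroup ℚ)} (α : U₁ ≃* U₂)
    (N : IntermediateField ℚ (AlgebraicClosure ℚ)) [FiniteDimensional ℚ N] (hNU : ΓK N ≤ U₁)
    (τ : absoluteGaloisGroup ℚ)
    (hτ : ∀ (n : absoluteGaloisGroup ℚ) (hn : n ∈ ΓK N),
      ((α ⟨n, hNU hn⟩ : U₂) : absoluteGaloisGroup ℚ) = τ * n * τ⁻¹) (u : U₁) :
    ((α u : U₂) : absoluteGaloisGroup ℚ) = τ * u * τ⁻¹ :=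
  eq_conj_of_eq_conj_on_isOpen_mulEquiv (galoisNF_slim_holds ℚ) α (isOpen_ΓK N) hNU τ hτ u

/-- **R7 (b), sub-DAG currency**: below an open `U ≤ Γ = G_ℚ` there is a finite Galois `N/ℚ` inside
`ℚ̄` with `Γ_N ≤ U` containing a primitive `ℓ`-th root of unity (`ℓ ≥ 1`).
[cite: NeukirchSchmidtWingberg2008, Thm (12.2.1)] -/
theorem exists_isGalois_primitiveRoot_ΓK_le (U : Subgroup (absoluteGaloisGroup ℚ))
    (hU : IsOpen (U : Set (absoluteGaloisGroup ℚ))) {ℓ : ℕ} (hℓ : 0 < ℓ) :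
    ∃ N : IntermediateField ℚ (AlgebraicClosure ℚ), FiniteDimensional ℚ N ∧ IsGalois ℚ N ∧
      ΓK N ≤ U ∧ ∃ ζ : AlgebraicClosure ℚ, ζ ∈ N ∧ IsPrimitiveRoot ζ ℓ := by
  obtain ⟨N, h1, h2, h3, h4⟩ :=
    exists_finiteDimensional_isGalois_primitiveRoot_fixingSubgroup_le ℚ U hU hℓ
  exact ⟨N, h1, h2, by rw [ΓK_eq_comap]; exact h3, h4⟩

/-- **R7 (b), finite-set form, sub-DAG currency**: below an open `U ≤ G_ℚ` there is a finite Galois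
`N/ℚ` inside `ℚ̄` with `Γ_N ≤ U` containing any prescribed finite set `S ⊆ ℚ̄`.
[cite: NeukirchSchmidtWingberg2008, Thm (12.2.1)] -/
theorem exists_isGalois_subset_ΓK_le (U : Subgroup (absoluteGaloisGroup ℚ))
    (hU : IsOpen (U : Set (absoluteGaloisGroup ℚ))) (S : Set (AlgebraicClosure ℚ)) (hS : S.Finite) :
    ∃ N : IntermediateField ℚ (AlgebraicClosure ℚ), FiniteDimensional ℚ N ∧ IsGalois ℚ N ∧
      S ⊆ N ∧ ΓK N ≤ U := by
  obtain ⟨N, h1, h2, h3, h4⟩ := exists_finiteDimensional_isGalois_fixingSubgroup_le ℚ U hU S hS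
  exact ⟨N, h1, h2, h3, by rw [ΓK_eq_comap]; exact h4⟩

/-- **R7 packaged for R11/R12**: if `α : U₁ ⥲ U₂` (`U₁, U₂ ≤ G_ℚ`) is conjugation by `τ` on `Γ_N` for
some finite `N/ℚ` with `Γ_N ≤ U₁`, then the `NeukirchUchida ℚ`-conclusion holds for `(U₁, U₂, α)`:
a field automorphism `ρ` of `ℚ̄` with `α(u)(ρ x) = ρ(u x)`.
[cite: NeukirchSchmidtWingberg2008, Thm (12.2.1)] -/
theorem exists_ringEquiv_of_eq_conj_on_ΓK {U₁ U₂ : Subgroup (absoluteGaloisGroup ℚ)} (α : U₁ ≃* U₂)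
    (N : IntermediateField ℚ (AlgebraicClosure ℚ)) [FiniteDimensional ℚ N] (hNU : ΓK N ≤ U₁)
    (τ : absoluteGaloisGroup ℚ)
    (hτ : ∀ (n : absoluteGaloisGroup ℚ) (hn : n ∈ ΓK N),
      ((α ⟨n, hNU hn⟩ : U₂) : absoluteGaloisGroup ℚ) = τ * n * τ⁻¹) :
    ∃ ρ : AlgebraicClosure ℚ ≃+* AlgebraicClosure ℚ, ∀ (u : U₁) (x : AlgebraicClosure ℚ),
      ((α u : U₂) : absoluteGaloisGroup ℚ) • ρ x = ρ ((u : absoluteGaloisGroup ℚ) • x) :=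
  exists_ringEquiv_of_forall_eq_conj α τ (eq_conj_of_eq_conj_on_ΓK α N hNU τ hτ)

end Rat

end NeukirchUchidaProof

end Literature.AnabelianGeometry.AbsoluteAnabelian

end
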